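import Literature.AlgebraicTopology.CharacteristicClasses.LineThomClassGluing
import Literature.AlgebraicTopology.SingularHomology.SphereLikeCupForm
import Literature.AlgebraicTopology.SingularHomology.CupProductProofs
import HarnessLib

/-!
# The Thom splitting of `H*(P(λ ⊕ ℂ)|_S)` over a trivialising set, in all degrees

J. Milnor, J. Stasheff, *Characteristic Classes* (1974), §10 (Thm. 10.2, the Thom isomorphism for a
product `B × ℝⁿ` in all degrees) in the projective-completion model and D. Husemoller,
*Fibre Bundles*, Ch. 17 §1 (the local form of Leray–Hirsch, `K(U) = H*(U) ⊕ H*⁻²(U)·a ≅ L(U) =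
H*(E_U)` for `U` trivialising): for a complex line bundle `λ`, a trivialising `S ⊆ U_e` and ANY
class `t ∈ H²(P(λ ⊕ ℂ)|_S; R)` with the fibre restrictions `ω_b(1)` of a Thom class,

  **`(a, b) ↦ π^* a + π^* b ⌣ t : Hᵏ⁺²(S) × Hᵏ(S) → Hᵏ⁺²(P(λ ⊕ ℂ)|_S)` is bijective**

(`thomSplitOn_bijective`), and `π^* : Hᵏ(S) → Hᵏ(P(λ ⊕ ℂ)|_S)` is bijective for `k = 0, 1`.
Proof: transport along the standard local product structure `P(λ ⊕ ℂ)|_S ≅ S × ℙ(ℂ ⊕ ℂ)`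
(`stdLocalHomeomorph`) to the cup-form Künneth splitting of `SphereLikeCupForm`; there `t`
corresponds to `pr₁^* a₀ + pr₂^* ω ⌣ pr₁^* c₀` with `c₀ ∈ H⁰(S)` ALL of whose point restrictions
are `1` (fibre restrictions of `t` are `ω`), so `c₀ = 1` (`eq_one_of_forall_map_const_eq_one`:
degree-zero classes are detected by points) and the map is the Künneth bijection composed with
the shear `(a, b) ↦ (a + b ⌣ a₀, b)`.

Everything is proved; no named facts.

## References

* J. Milnor, J. Stasheff, *Characteristic Classes*, PUP 1974, §10 Thm. 10.2. [MilnorStasheff1974]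
* D. Husemoller, *Fibre Bundles*, GTM 20, Springer 1994, Ch. 17 §1 Thm. 1.1. [HusemollerFibreBundles1994]
* A. Hatcher, *Algebraic Topology*, CUP 2002, §3.2 Thm. 3.16. [HatcherAT2002]
-/

noncomputable section

open CategoryTheory Function Set Bundle Literature.AlgebraicTopology.SingularHomology
open scoped LinearAlgebra.Projectivization

universe u

namespace Literature.AlgebraicTopology.SingularHomology

/-! ### Degree zero: a class all of whose point restrictions are `1` is `1` -/

/-- **A class of `H⁰(X; R)` restricting to `1` at every point is `1`** (degree-zero classes are
detected by points). [cite: HatcherAT2002, §3.1 p. 199] -/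
theorem singularCohomology.eq_one_of_forall_map_const_eq_one {R : Type u} [CommRing R] {X : Type u} [TopologicalSpace X]
    (c : singularCohomology R R X 0)
    (h : ∀ x : X, singularCohomology.map R R (ContinuousMap.const PUnit.{u + 1} x) 0 c = singularCohomology.one R PUnit.{u + 1}) :
    c = singularCohomology.one R X := by
  rw [← sub_eq_zero]
  refine singularCohomology.eq_zero_of_forall_map_const_eq_zero (R := R) (M := R) _ fun x ↦ ?_
  rw [map_sub, h x, singularCohomology.map_one, sub_self]

end Literature.AlgebraicTopology.SingularHomology

namespace Literature.AlgebraicTopology.CharacteristicClasses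

variable {B : Type u} [TopologicalSpace B] (F : Type u) [NormedAddCommGroup F] [NormedSpace ℂ F] [FiniteDimensional ℂ F]
  (E : B → Type u) [∀ b, AddCommGroup (E b)] [∀ b, Module ℂ (E b)]
  [TopologicalSpace (TotalSpace F E)] [∀ b, TopologicalSpace (E b)] [FiberBundle F E] [VectorBundle ℂ F E]
  (hF : Module.finrank ℂ F = 1) (R : Type u) [CommRing R]

/-- **The Thom splitting map over `S`**: `(a, b) ↦ π^* a + π^* b ⌣ t : Hᵏ⁺²(S) × Hᵏ(S) → Hᵏ⁺²(P(λ ⊕ ℂ)|_S)`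
for a class `t ∈ H²(P(λ ⊕ ℂ)|_S)`. [cite: MilnorStasheff1974, §10 Thm. 10.2] -/
def thomSplitOn {S : Set B} (t : singularCohomology R R ↥(complPreimage F E S) 2) (k : ℕ) :
    (singularCohomology R R ↥S (k + 2) × singularCohomology R R ↥S k) →ₗ[R]
      singularCohomology R R ↥(complPreimage F E S) (k + 2) :=
  (singularCohomology.map R R (complProjOn F E S) (k + 2)).hom.coprod
    ((cupProduct (show k + 2 = k + 2 from rfl)).flip t ∘ₗ (singularCohomology.map R R (complProjOn F E S) k).hom)

/-- `thomSplitOn t k (a, b) = π^* a + π^* b ⌣ t`. [folklore] -/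
theorem thomSplitOn_apply {S : Set B} (t : singularCohomology R R ↥(complPreimage F E S) 2) (k : ℕ)
    (a : singularCohomology R R ↥S (k + 2)) (b : singularCohomology R R ↥S k) :
    thomSplitOn F E R t k (a, b) =
      singularCohomology.map R R (complProjOn F E S) (k + 2) a +
        cupProduct (show k + 2 = k + 2 from rfl) (singularCohomology.map R R (complProjOn F E S) k b) t := rfl

variable (e : Trivialization F (π F E)) [MemTrivializationAtlas e]

/-- `π ∘ h⁻¹ = pr₁` for the standard local product structure `h`. [folklore] -/
theorem complProjOn_comp_stdLocalHomeomorph_symm {S : Set B} (hS : S ⊆ e.baseSet) :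
    (complProjOn F E S).comp ((stdLocalHomeomorph hF e hS).symm : C(↥S × ℙ ℂ (ULift.{u} ℂ × ℂ), ↥(complPreimage F E S))) =
      ContinuousMap.fst := by
  ext1 q
  obtain ⟨s, ℓ⟩ := q
  apply Subtype.ext
  change ((stdLocalHomeomorph hF e hS).symm (s, ℓ)).1.proj = s.1
  have h1 : (stdLocalHomeomorph hF e hS) ((stdLocalHomeomorph hF e hS).symm (s, ℓ)) = (s, ℓ) :=
    (stdLocalHomeomorph hF e hS).apply_symm_apply (s, ℓ)
  set q := (stdLocalHomeomorph hF e hS).symm (s, ℓ) with hq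
  obtain ⟨⟨b, ℓ'⟩, hb⟩ := q
  rw [stdLocalHomeomorph_apply_mk hF e hS hb] at h1
  exact congrArg Subtype.val (congrArg Prod.fst h1)

/-- The model generator `ω = ω(1) ∈ H²(ℙ(ℂ ⊕ ℂ); R)` of the fixed model line. [folklore] -/
abbrev omegaOne : singularCohomology R R (ℙ ℂ (ULift.{u} ℂ × ℂ)) 2 :=
  (modelSphereLike (ULift.{u} ℂ) finrank_model).omegaFibre R R 1

/-- **Transport of a fibre-normalised class**: under `P(λ ⊕ ℂ)|_S ≅ S × ℙ(ℂ ⊕ ℂ)`, a class with the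
fibre restrictions `ω_b(1)` becomes `pr₁^* a₀ + pr₂^* ω` for some `a₀ ∈ H²(S)` (its `H⁰`-coefficient
has all point restrictions `1`, hence is `1`). [cite: HusemollerFibreBundles1994, Ch. 17 §1 Thm. 1.1 (proof)] -/
theorem exists_map_symm_eq_add {S : Set B} (hS : S ⊆ e.baseSet) (t : singularCohomology R R ↥(complPreimage F E S) 2)
    (ht : ∀ (b : B) (hb : b ∈ S), singularCohomology.map R R (complFibOn hb) 2 t = omegaFib F E hF R R b 1) :
    ∃ a₀ : singularCohomology R R ↥S 2,
      singularCohomology.map R R ((stdLocalHomeomorph hF e hS).symm : C(↥S × ℙ ℂ (ULift.{u} ℂ × ℂ), ↥(complPreimage F E S))) 2 t =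
        singularCohomology.map R R (ContinuousMap.fst : C(↥S × ℙ ℂ (ULift.{u} ℂ × ℂ), ↥S)) 2 a₀ +
          singularCohomology.map R R (ContinuousMap.snd : C(↥S × ℙ ℂ (ULift.{u} ℂ × ℂ), ℙ ℂ (ULift.{u} ℂ × ℂ))) 2 (omegaOne R) := by
  set hY := modelSphereLike (ULift.{u} ℂ) finrank_model with hhY
  set τ := singularCohomology.map R R ((stdLocalHomeomorph hF e hS).symm :
    C(↥S × ℙ ℂ (ULift.{u} ℂ × ℂ), ↥(complPreimage F E S))) 2 t with hτ
  obtain ⟨⟨a₀, c₀⟩, hac⟩ := hY.sphereMap_surjective R R (U := ↥S) 0 τ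
  refine ⟨a₀, ?_⟩
  -- every point restriction of `c₀` is `1`
  have hc₀ : c₀ = singularCohomology.one R ↥S := by
    refine singularCohomology.eq_one_of_forall_map_const_eq_one c₀ fun u ↦ ?_
    obtain ⟨m, hm⟩ := exists_eq_constClass_punit (R := R) (M := R) (singularCohomology.map R R (ContinuousMap.const PUnit.{u + 1} u) 0 c₀)
    -- the fibre restriction of `τ` at `u` is `ω(m)` and also `ω(1)`
    have h1 : singularCohomology.map R R (fibreIncl u) 2 τ = hY.omegaFibre R R m := by
      have hz : singularCohomology.map R R (ContinuousMap.const PUnit.{u + 1} u) (0 + 2) a₀ = 0 :=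
        (ModuleCat.subsingleton_of_isZero (singularCochainComplex.isZero_singularCohomology_of_subsingleton'
          (R := R) (M := R) (X := PUnit.{u + 1}) (n := 0 + 2) two_ne_zero)).elim _ _
      rw [← hac, hY.map_fibreIncl_sphereMap R R, hz, hm]
      rfl
    have h2 : singularCohomology.map R R (fibreIncl u) 2 τ = hY.omegaFibre R R 1 := by
      obtain ⟨b, hb⟩ := u
      have hc : ((stdLocalHomeomorph hF e hS).symm : C(↥S × ℙ ℂ (ULift.{u} ℂ × ℂ), ↥(complPreimage F E S))).comp
          (fibreIncl (⟨b, hb⟩ : ↥S)) =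
            (complFibOn hb).comp ((homeomorphOfContinuousLinearEquiv
              (((linEquivAt ℂ F E e b).trans (stdEquiv F hF)).prodCongr (ContinuousLinearEquiv.refl ℂ ℂ))).symm :
                C(ℙ ℂ (ULift.{u} ℂ × ℂ), ℙ ℂ (E b × ℂ))) := by
        ext1 ℓ
        apply (stdLocalHomeomorph hF e hS).injective
        change stdLocalHomeomorph hF e hS ((stdLocalHomeomorph hF e hS).symm (⟨b, hb⟩, ℓ)) =
          stdLocalHomeomorph hF e hS ⟨⟨b, (homeomorphOfContinuousLinearEquiv
            (((linEquivAt ℂ F E e b).trans (stdEquiv F hF)).prodCongr (ContinuousLinearEquiv.refl ℂ ℂ))).symm ℓ⟩, hb⟩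
        rw [Homeomorph.apply_symm_apply, stdLocalHomeomorph_apply_mk hF e hS hb]
        exact Prod.ext rfl ((homeomorphOfContinuousLinearEquiv _).apply_symm_apply ℓ).symm
      rw [hτ, ← ModuleCat.comp_apply, ← singularCohomology.map_comp, hc, singularCohomology.map_comp,
        ModuleCat.comp_apply, ht b hb, ← map_projProd_omegaModel F E hF R R b (linEquivAt ℂ F E e b) 1,
        ← ModuleCat.comp_apply, ← singularCohomology.map_comp, Homeomorph.toContinuousMap_comp_symm,
        singularCohomology.map_id]
      rfl
    have hm1 : m = 1 := (hY.omegaFibre_bijective R R).1 (h1.symm.trans h2)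
    rw [hm, hm1, constClass_one_eq_one]
  rw [← hac, hc₀, hY.sphereMap_apply R R, hY.sigmaMap_one_eq_map_snd_omegaFibre R]

/-- **Under the local product structure the Thom splitting is the Künneth splitting sheared by `a₀`**:
`h⁻¹^*(π^* a + π^* b ⌣ t) = pr₁^*(a + b ⌣ a₀) + pr₂^* ω ⌣ pr₁^* b`. [cite: HusemollerFibreBundles1994, Ch. 17 §1 Thm. 1.1 (proof)] -/
theorem map_symm_thomSplitOn {S : Set B} (hS : S ⊆ e.baseSet) (t : singularCohomology R R ↥(complPreimage F E S) 2)
    (a₀ : singularCohomology R R ↥S 2)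
    (hτ : singularCohomology.map R R ((stdLocalHomeomorph hF e hS).symm :
      C(↥S × ℙ ℂ (ULift.{u} ℂ × ℂ), ↥(complPreimage F E S))) 2 t =
        singularCohomology.map R R (ContinuousMap.fst : C(↥S × ℙ ℂ (ULift.{u} ℂ × ℂ), ↥S)) 2 a₀ +
          singularCohomology.map R R (ContinuousMap.snd : C(↥S × ℙ ℂ (ULift.{u} ℂ × ℂ), ℙ ℂ (ULift.{u} ℂ × ℂ))) 2 (omegaOne R))
    (k : ℕ) (a : singularCohomology R R ↥S (k + 2)) (b : singularCohomology R R ↥S k) :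
    singularCohomology.map R R ((stdLocalHomeomorph hF e hS).symm :
        C(↥S × ℙ ℂ (ULift.{u} ℂ × ℂ), ↥(complPreimage F E S))) (k + 2) (thomSplitOn F E R t k (a, b)) =
      singularCohomology.map R R (ContinuousMap.fst : C(↥S × ℙ ℂ (ULift.{u} ℂ × ℂ), ↥S)) (k + 2)
          (a + cupProduct (show k + 2 = k + 2 from rfl) b a₀) +
        cupProduct (show 2 + k = k + 2 by omega)
          (singularCohomology.map R R (ContinuousMap.snd : C(↥S × ℙ ℂ (ULift.{u} ℂ × ℂ), ℙ ℂ (ULift.{u} ℂ × ℂ))) 2 (omegaOne R))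
          (singularCohomology.map R R (ContinuousMap.fst : C(↥S × ℙ ℂ (ULift.{u} ℂ × ℂ), ↥S)) k b) := by
  have hπ : ∀ (n : ℕ) (c : singularCohomology R R ↥S n),
      singularCohomology.map R R ((stdLocalHomeomorph hF e hS).symm : C(↥S × ℙ ℂ (ULift.{u} ℂ × ℂ), ↥(complPreimage F E S))) n
        (singularCohomology.map R R (complProjOn F E S) n c) =
        singularCohomology.map R R (ContinuousMap.fst : C(↥S × ℙ ℂ (ULift.{u} ℂ × ℂ), ↥S)) n c := by
    intro n c
    rw [← ModuleCat.comp_apply, ← singularCohomology.map_comp, complProjOn_comp_stdLocalHomeomorph_symm]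
  have hcomm : cupProduct (show k + 2 = k + 2 from rfl)
      (singularCohomology.map R R (ContinuousMap.fst : C(↥S × ℙ ℂ (ULift.{u} ℂ × ℂ), ↥S)) k b)
      (singularCohomology.map R R (ContinuousMap.snd : C(↥S × ℙ ℂ (ULift.{u} ℂ × ℂ), ℙ ℂ (ULift.{u} ℂ × ℂ))) 2 (omegaOne R)) =
      cupProduct (show 2 + k = k + 2 by omega)
        (singularCohomology.map R R (ContinuousMap.snd : C(↥S × ℙ ℂ (ULift.{u} ℂ × ℂ), ℙ ℂ (ULift.{u} ℂ × ℂ))) 2 (omegaOne R))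
        (singularCohomology.map R R (ContinuousMap.fst : C(↥S × ℙ ℂ (ULift.{u} ℂ × ℂ), ↥S)) k b) := by
    rw [cupProduct_gradedComm_holds R _ (show k + 2 = k + 2 from rfl) (show 2 + k = k + 2 by omega)]
    simp only [even_two, Even.mul_left, Even.neg_pow, one_pow, one_smul]
  rw [thomSplitOn_apply, map_add, hπ, cupProduct_map, hπ, hτ, map_add, map_add, cupProduct_map, hcomm]
  abel

/-- The shear `(a, b) ↦ (a + b ⌣ a₀, b)` is bijective. [folklore] -/
theorem shear_bijective {S : Set B} (a₀ : singularCohomology R R ↥S 2) (k : ℕ) :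
    Bijective fun p : singularCohomology R R ↥S (k + 2) × singularCohomology R R ↥S k ↦
      (p.1 + cupProduct (show k + 2 = k + 2 from rfl) p.2 a₀, p.2) := by
  refine ⟨fun p q h ↦ ?_, fun q ↦ ⟨(q.1 - cupProduct (show k + 2 = k + 2 from rfl) q.2 a₀, q.2), ?_⟩⟩
  · obtain ⟨h1, h2⟩ := Prod.mk.inj h
    have h2' : p.2 = q.2 := h2
    rw [h2'] at h1
    exact Prod.ext (add_right_cancel h1) h2'
  · simp

omit [FiniteDimensional ℂ F] in
/-- **The Thom splitting over a trivialising set is bijective in all degrees** for every class with the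
fibre restrictions of a Thom class (Milnor–Stasheff Thm. 10.2 for `B × ℝⁿ`; Husemoller's local
Leray–Hirsch isomorphism `K(U) ≅ L(U)`). [cite: MilnorStasheff1974, §10 Thm. 10.2] -/
theorem thomSplitOn_bijective [FiniteDimensional ℂ F] {S : Set B} (hS : S ⊆ e.baseSet)
    (t : singularCohomology R R ↥(complPreimage F E S) 2)
    (ht : ∀ (b : B) (hb : b ∈ S), singularCohomology.map R R (complFibOn hb) 2 t = omegaFib F E hF R R b 1) (k : ℕ) :
    Bijective (thomSplitOn F E R t k) := by
  obtain ⟨a₀, hτ⟩ := exists_map_symm_eq_add F E hF R e hS t ht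
  set hY := modelSphereLike (ULift.{u} ℂ) finrank_model
  have hT : Bijective (singularCohomology.map R R ((stdLocalHomeomorph hF e hS).symm :
      C(↥S × ℙ ℂ (ULift.{u} ℂ × ℂ), ↥(complPreimage F E S))) (k + 2)) :=
    (singularCohomology.mapIso R R (stdLocalHomeomorph hF e hS).symm (k + 2)).toLinearEquiv.bijective
  have hcomp : (singularCohomology.map R R ((stdLocalHomeomorph hF e hS).symm :
      C(↥S × ℙ ℂ (ULift.{u} ℂ × ℂ), ↥(complPreimage F E S))) (k + 2)) ∘ (thomSplitOn F E R t k) =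
      (fun p : singularCohomology R R ↥S (k + 2) × singularCohomology R R ↥S k ↦
        singularCohomology.map R R (ContinuousMap.fst : C(↥S × ℙ ℂ (ULift.{u} ℂ × ℂ), ↥S)) (k + 2) p.1 +
          cupProduct (show 2 + k = k + 2 by omega)
            (singularCohomology.map R R (ContinuousMap.snd : C(↥S × ℙ ℂ (ULift.{u} ℂ × ℂ), ℙ ℂ (ULift.{u} ℂ × ℂ))) 2
              (hY.omegaFibre R R 1))
            (singularCohomology.map R R (ContinuousMap.fst : C(↥S × ℙ ℂ (ULift.{u} ℂ × ℂ), ↥S)) k p.2)) ∘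
        (fun p : singularCohomology R R ↥S (k + 2) × singularCohomology R R ↥S k ↦
          (p.1 + cupProduct (show k + 2 = k + 2 from rfl) p.2 a₀, p.2)) := by
    funext p
    exact map_symm_thomSplitOn F E hF R e hS t a₀ hτ k p.1 p.2
  have hB : Bijective ((singularCohomology.map R R ((stdLocalHomeomorph hF e hS).symm :
      C(↥S × ℙ ℂ (ULift.{u} ℂ × ℂ), ↥(complPreimage F E S))) (k + 2)) ∘ (thomSplitOn F E R t k)) := by
    rw [hcomp]
    exact (hY.cupSplit_bijective R k).comp (shear_bijective R a₀ k)
  exact ⟨fun p q h ↦ hB.1 (congrArg (singularCohomology.map R R ((stdLocalHomeomorph hF e hS).symm :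
      C(↥S × ℙ ℂ (ULift.{u} ℂ × ℂ), ↥(complPreimage F E S))) (k + 2)) h :), fun y ↦ by
    obtain ⟨p, hp⟩ := hB.2 (singularCohomology.map R R ((stdLocalHomeomorph hF e hS).symm :
      C(↥S × ℙ ℂ (ULift.{u} ℂ × ℂ), ↥(complPreimage F E S))) (k + 2) y)
    exact ⟨p, hT.1 hp⟩⟩

end Literature.AlgebraicTopology.CharacteristicClasses
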